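import Summits.QuantumAdvantage.QuantumAdvantage.Theorems.LinnikCubicClassGroupsDegreeOnePrimesEscapeSplittingTypeDivision
import Summits.QuantumAdvantage.QuantumAdvantage.Theorems.LinnikCubicClassGroupsDegreeOnePrimesEscapeDivisionPNTPiCongr
import HarnessLib

/-!
# The Chebotarev density theorem for splitting types in the Linnik range (`S_n`-fields)

Topic `Summits/QuantumAdvantage/QuantumAdvantage/Theorems`, cell B2b-1 (linnik-cubic), PART A (gen 11);
helper toward the crux `DegreeOnePrimesEscape` (stmt-QuantumAdvantage-11543) of route
`LinnikCubicClassGroups`.  HONEST FRAMING: the value of this file is a THEOREM (kernel-checked, GRH-free,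
Siegel-free, no hypothesis) — NOT summit progress.

**Theorem** (`splittingType_PNT_of_symmetric`).  Let `n > 1` and `0 < ε ≤ 1`.  There are `L, c > 0` such
that for every number field `K` of degree `n` all of whose Galois splitting fields have degree `≥ n!` (an
"`S_n`-field") there are `θ ∈ {0, 1}` and `β₁ ∈ (1 − c/(log|d_K| + log 4), 1)` (depending only on `K`;
`c ≤ 1/4`, so `β₁ ≥ 3/4`) with
the following property: for EVERY partition `T` of `n` (multiset of positive integers with `Σ T = n`) and every
`x ≥ |d_K|^L`,

  `|π_T(x) − δ_T (Li(x) − θ (−1)^{n − |T|} Li(x^{β₁}))| ≤ ε δ_T (Li(x) − θ (−1)^{n − |T|} Li(x^{β₁}))`,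

where `π_T(x) = #{p ≤ x : splittingType K p = T}` counts ALL primes `p ≤ x` whose splitting type in `K`
(the multiset of residue degrees of the primes of `K` above `p`) is `T`, `δ_T = #{τ ∈ S_n : cycle type of τ,
padded with fixed points, = T}/n!` is the Chebotarev density of `T`, `Li = offsetLogIntegral`, and
`(−1)^{n − |T|}` is the sign of the permutations of cycle structure `T`.  Here `θ = 0` unless the Dedekind zeta
function of the Galois closure of `K` has a real zero `β₁` in the window, in which case `θ = 1` and the
secondary term `∓ Li(x^{β₁})` appears with the sign of the class (the exceptional zero lives in the quadratic
resolvent `ℚ(√d_K) = N^{A_n}`, Heilbronn–Stark).  This is the Lagarias–Montgomery–Odlyzko / Thorner–Zaman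
Chebotarev prime number theorem [LagariasMontgomeryOdlyzko1979, Thm 1.1; ThornerZaman2019, Thm 1.4] for the
symmetric group read through Dedekind's cycle-type dictionary, with inexplicit `L(n, ε)`, `c(n, ε)`.

Proof: the embedded `S_n`-closure (`symmetricClosure`), the division prime number theorem for an arbitrary
prime predicate (`division_PNT_pi_congr`, absorbing the `≤ 2 log|d_N|` ramified primes), the dictionary
`frobenius_division_iff_splittingType_eq` / `natCard_division_eq_card_filter_fullCycleType`, and
Heilbronn–Stark (`exists_index_two_of_exceptional`) with `mem_iff_sign_eq_one_of_index_two` to read the sign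
of the exceptional term off the parity of `T`.
-/

noncomputable section

open scoped NumberField nonZeroDivisors
open Finset Real Ideal NumberField
open Literature.NumberTheory.NumberFields Literature.NumberTheory.LFunctions
  Literature.NumberTheory.LFunctions.NumberField

namespace Summit.QuantumAdvantage.QuantumAdvantage.Theorems.DegreeOnePrimesEscape

/-- `(−1)^k = 1` in `ℤˣ` forces `k` even, `≠ 1` forces `k` odd; read in `ℝ`. -/
theorem neg_one_pow_real_of_units {k : ℕ} :
    (((-1 : ℤˣ) ^ k = 1) → ((-1 : ℝ) ^ k = 1)) ∧ (((-1 : ℤˣ) ^ k ≠ 1) → ((-1 : ℝ) ^ k = -1)) := by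
  rcases Nat.even_or_odd k with hk | hk
  · exact ⟨fun _ => hk.neg_one_pow, fun h => absurd hk.neg_one_pow h⟩
  · refine ⟨fun h => ?_, fun _ => hk.neg_one_pow⟩
    have h2 : (-1 : ℤˣ) ^ k = -1 := hk.neg_one_pow
    rw [h2] at h
    exact absurd h (by decide)

set_option maxHeartbeats 4000000 in
/-- **The Chebotarev density theorem for splitting types in the Linnik range, for `S_n`-fields** (see the
module docstring).  Unconditional. [cite: LagariasMontgomeryOdlyzko1979, Theorem 1.1]
[cite: ThornerZaman2019, Theorem 1.4] [cite: Perlis1977, §1] -/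
theorem splittingType_PNT_of_symmetric (n : ℕ) [NeZero n] (hn : 1 < n) {ε : ℝ} (hε : 0 < ε) (hε1 : ε ≤ 1) :
    ∃ L c : ℝ, 0 < L ∧ 0 < c ∧ c ≤ 1 / 4 ∧ ∀ (K : Type) [Field K] [NumberField K], Module.finrank ℚ K = n →
      (∀ (M : Type) [Field M] [NumberField M] [IsGalois ℚ M],
        (K →ₐ[ℚ] M) → n.factorial ≤ Module.finrank ℚ M) →
      ∃ θ β₁ : ℝ, (θ = 0 ∨ θ = 1) ∧
        1 - c / (Real.log ((NumberField.discr K).natAbs : ℝ) + Real.log 4) < β₁ ∧ β₁ < 1 ∧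
        ∀ T : Multiset ℕ, T.sum = n → (∀ f ∈ T, 0 < f) →
          ∀ x : ℝ, ((NumberField.discr K).natAbs : ℝ) ^ L ≤ x →
            |((((Nat.primesLE ⌊x⌋₊).filter (fun p : ℕ => splittingType K p = T)).card : ℕ) : ℝ) -
                ((Finset.univ.filter fun q : Equiv.Perm (Fin n) =>
                    q.cycleType + Multiset.replicate (n - q.support.card) 1 = T).card : ℝ) / n.factorial *
                  (offsetLogIntegral x - θ * (-1) ^ (n - Multiset.card T) * offsetLogIntegral (x ^ β₁))| ≤
              ε * (((Finset.univ.filter fun q : Equiv.Perm (Fin n) =>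
                    q.cycleType + Multiset.replicate (n - q.support.card) 1 = T).card : ℝ) / n.factorial *
                  (offsetLogIntegral x - θ * (-1) ^ (n - Multiset.card T) * offsetLogIntegral (x ^ β₁))) := by
  have hnf : 1 < n.factorial := lt_of_lt_of_le hn (Nat.self_le_factorial n)
  obtain ⟨L₀, c, hL₀, hc, -, hc4, h⟩ := division_PNT_pi_congr n.factorial hnf hε hε1 one_pos
  refine ⟨n.factorial * L₀, c, by positivity, hc, hc4, fun K _ _ hK hSn => ?_⟩
  obtain ⟨N, _, _, hGal, hdeg, K', e, ψ, hstab, hdN⟩ := symmetricClosure n K hK hSn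
  haveI := hGal
  have hN1 : 1 < Module.finrank ℚ N := by rw [hdeg]; exact hnf
  -- sizes
  set d : ℝ := ((NumberField.discr K).natAbs : ℝ) with hd
  set dN : ℝ := ((NumberField.discr N).natAbs : ℝ) with hdN'
  have hd3 : (3 : ℝ) ≤ d := three_le_natAbs_discr_real K (by rw [hK]; exact hn)
  have hd1 : (1 : ℝ) ≤ d := by linarith
  have hdN3 : (3 : ℝ) ≤ dN := three_le_natAbs_discr_real N hN1
  have hdisc' : NumberField.discr K' = NumberField.discr K := (NumberField.discr_eq_discr_of_algEquiv K e).symm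
  have hdKN : d ≤ dN := by
    have hdvd : NumberField.discr K ∣ NumberField.discr N := hdisc' ▸ NumberField.discr_dvd_discr K' N
    rw [hd, hdN']
    exact_mod_cast Nat.le_of_dvd (Int.natAbs_pos.mpr (NumberField.discr_ne_zero N)) (Int.natAbs_dvd_natAbs.mpr hdvd)
  have hℓK : 0 < Real.log d + Real.log 4 := by
    have := Real.log_pos (by linarith : (1 : ℝ) < d); have := Real.log_pos (by norm_num : (1 : ℝ) < 4)
    linarith
  have hwinKN : 1 - c / (Real.log d + Real.log 4) ≤ 1 - c / (Real.log dN + Real.log 4) := by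
    have h1 : Real.log d ≤ Real.log dN := Real.log_le_log (by linarith) hdKN
    have h2 : c / (Real.log dN + Real.log 4) ≤ c / (Real.log d + Real.log 4) :=
      div_le_div_of_nonneg_left hc.le hℓK (by linarith)
    linarith
  have hxN : ∀ x : ℝ, d ^ ((n.factorial : ℝ) * L₀) ≤ x → dN ^ L₀ ≤ x := by
    intro x hx
    have hdNR : dN ≤ d ^ (n.factorial : ℝ) := by
      rw [Real.rpow_natCast, hd, hdN']; exact_mod_cast hdN
    calc dN ^ L₀ ≤ (d ^ (n.factorial : ℝ)) ^ L₀ := Real.rpow_le_rpow (by linarith) hdNR hL₀.le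
      _ = d ^ ((n.factorial : ℝ) * L₀) := by rw [← Real.rpow_mul (by linarith)]
      _ ≤ x := hx
  -- the dictionary for a partition `T`: a permutation `τ`, `σ = ψ⁻¹ τ`, the predicate and the density
  have hcardFin : Fintype.card (Fin n) = n := Fintype.card_fin n
  have hdict : ∀ T : Multiset ℕ, T.sum = n → (∀ f ∈ T, 0 < f) → ∃ σ : N ≃ₐ[ℚ] N,
      (ψ σ).cycleType + Multiset.replicate (n - (ψ σ).support.card) 1 = T ∧
      (∀ p : ℕ, p.Prime → ¬ ((p : ℤ) ∣ NumberField.discr N) →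
        (splittingType K p = T ↔ ∃ (Q : Ideal (𝓞 N)) (_ : Q.IsMaximal) (_ : Q.LiesOver (span {(p : ℤ)}))
          (φ g : N ≃ₐ[ℚ] N), IsArithFrobAt ℤ φ Q ∧ Q.inertia (N ≃ₐ[ℚ] N) = ⊥ ∧
            Subgroup.zpowers (g * φ * g⁻¹) = Subgroup.zpowers σ)) ∧
      (Nat.card {τ : N ≃ₐ[ℚ] N // ∃ g : N ≃ₐ[ℚ] N,
          Subgroup.zpowers (g * τ * g⁻¹) = Subgroup.zpowers σ} : ℝ) / Nat.card (N ≃ₐ[ℚ] N) =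
        ((Finset.univ.filter fun q : Equiv.Perm (Fin n) =>
            q.cycleType + Multiset.replicate (n - q.support.card) 1 = T).card : ℝ) / n.factorial := by
    intro T hTsum hTpos
    obtain ⟨τ, hτ⟩ := exists_fullCycleType_eq (α := Fin n) T (by rw [hcardFin]; exact hTsum) hTpos
    rw [hcardFin] at hτ
    refine ⟨ψ.symm τ, by rw [MulEquiv.apply_symm_apply]; exact hτ, fun p hp hpN => ?_, ?_⟩
    · rw [frobenius_division_iff_splittingType_eq K' ψ hstab (ψ.symm τ) hp hpN, MulEquiv.apply_symm_apply, hτ,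
        ArithmeticallyEquivalent.of_algEquiv e p hp]
    · rw [natCard_division_eq_card_filter_fullCycleType ψ, MulEquiv.apply_symm_apply, hτ,
        IsGalois.card_aut_eq_finrank, hdeg]
  -- the exceptional zero of `ζ_N`
  by_cases hexc : ∃ β₁ : ℝ, dedekindZeta₁ N β₁ = 0 ∧
      1 - c / (Real.log dN + Real.log 4) < β₁ ∧ β₁ < 1
  · obtain ⟨β₁, hζ₁, hβ₁c, hβ₁1⟩ := hexc
    obtain ⟨K₁, hK₁, hiff⟩ := exists_index_two_of_exceptional hN1 hc4 hζ₁ hβ₁c hβ₁1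
    refine ⟨1, β₁, Or.inr rfl, lt_of_le_of_lt hwinKN hβ₁c, hβ₁1, fun T hTsum hTpos x hx => ?_⟩
    obtain ⟨σ, hσT, hP, hδ⟩ := hdict T hTsum hTpos
    obtain ⟨-, hB⟩ := h N hdeg σ (fun p : ℕ => splittingType K p = T) hP
    obtain ⟨hB1, hB2⟩ := hB β₁ hζ₁ hβ₁c hβ₁1
    -- the sign of the class
    have hsign : Equiv.Perm.sign (ψ σ) = (-1) ^ (n - Multiset.card T) := by
      rw [sign_eq_neg_one_pow_card_sub, hcardFin, hσT]
    have hmemiff := mem_iff_sign_eq_one_of_index_two ψ K₁ hK₁ σ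
    have hzeta_iff : dedekindZeta₁ (IntermediateField.fixedField (Subgroup.zpowers σ)) β₁ = 0 ↔ σ ∈ K₁ := by
      rw [hiff, Subgroup.zpowers_le]
    by_cases hσK : σ ∈ K₁
    · -- `σ ∈ K₁`: even class, main term `Li(x) − Li(x^{β₁})`
      have h1 : (-1 : ℝ) ^ (n - Multiset.card T) = 1 :=
        neg_one_pow_real_of_units.1 (hsign ▸ hmemiff.mp hσK)
      have hmain := hB1 (hzeta_iff.mpr hσK) x (hxN x hx)
      rw [hδ] at hmain
      have e1 : offsetLogIntegral x - 1 * (-1 : ℝ) ^ (n - Multiset.card T) * offsetLogIntegral (x ^ β₁) =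
          offsetLogIntegral x - offsetLogIntegral (x ^ β₁) := by rw [h1]; ring
      rw [e1]
      exact hmain
    · -- `σ ∉ K₁`: odd class, main term `Li(x) + Li(x^{β₁})`
      have h1 : (-1 : ℝ) ^ (n - Multiset.card T) = -1 :=
        neg_one_pow_real_of_units.2 (hsign ▸ fun hs => hσK (hmemiff.mpr hs))
      have hmain := hB2 (fun h0 => hσK (hzeta_iff.mp h0)) x (hxN x hx)
      rw [hδ] at hmain
      have e1 : offsetLogIntegral x - 1 * (-1 : ℝ) ^ (n - Multiset.card T) * offsetLogIntegral (x ^ β₁) =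
          offsetLogIntegral x + offsetLogIntegral (x ^ β₁) := by rw [h1]; ring
      rw [e1]
      exact hmain
  · -- no exceptional zero: `θ = 0`
    refine ⟨0, 1 - c / (2 * (Real.log d + Real.log 4)), Or.inl rfl, ?_, ?_, fun T hTsum hTpos x hx => ?_⟩
    · have : c / (2 * (Real.log d + Real.log 4)) < c / (Real.log d + Real.log 4) := by
        rw [div_lt_div_iff_of_pos_left hc (by positivity) hℓK]; linarith
      linarith
    · have : 0 < c / (2 * (Real.log d + Real.log 4)) := by positivity
      linarith
    obtain ⟨σ, hσT, hP, hδ⟩ := hdict T hTsum hTpos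
    obtain ⟨hA, -⟩ := h N hdeg σ (fun p : ℕ => splittingType K p = T) hP
    have hmain := hA hexc x (hxN x hx)
    rw [hδ] at hmain
    have e1 : offsetLogIntegral x - 0 * (-1 : ℝ) ^ (n - Multiset.card T) * offsetLogIntegral (x ^ (1 - c / (2 * (Real.log d + Real.log 4)))) =
        offsetLogIntegral x := by ring
    rw [e1]
    exact hmain

end Summit.QuantumAdvantage.QuantumAdvantage.Theorems.DegreeOnePrimesEscape

end
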